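import Summits.BirchSwinnertonDyer.Rank1Residual.X5.TwoAdicTargetsEnd
import Summits.BirchSwinnertonDyer.Rank1Residual.X5.TwoAdicTargetsLead
import Summits.BirchSwinnertonDyer.Rank1Residual.X5.TwoAdicTargetsB
import HarnessLib

/-!
# Class O1 (X5, `p = 2`, non-CM): the END-STATE at `2` on O1-A-go ∧ r0 (G11b–e) — consumers of the
# `2`-adic chain `chainUpperAtTwo_of_divisibilityUpTo`

HONEST FRAMING (cell `b2b-bsdres`, run/shared/lean/b2b/bsd-rank1-residual/, verbatim in every
file): the goal of the cell is to DELETE the COMBINATION-SHAPED residual classes of the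
Birch–Swinnerton-Dyer formula for ALL analytic-rank `≤ 1` elliptic curves over `ℚ` — "full BSD
formula for every rank `≤ 1` curve in class `C`" assembled STRICTLY from published theorems — so
that the rank-`≤ 1` remainder becomes exactly the CONSTRUCTION-SHAPED classes, which are TYPED
(missing-input `Prop`s), NOT attempted. This is not "finishing BSD". Research routes; no claim
beyond stated classes; census output = EVIDENCE, never a Literature fact; nothing here is booked;
no mark of RESIDUAL-MAP §I moves.

Unit `b2b-bsdres-cc-typer-4` (lane CLASS-CLOSURE, class O1), gen 2, eleventh file of the O1 typer
folder: the consumers G11b–e of the o1 class lead's planner deliverable G11 (`HOME/cells/o1/PLAN.md`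
v2.2 §10.3 C24; sketch `HOME/b2b-bsdres-o1-lead/G11-EndStateAtTwo.Sketch.lean`, sha16
e45e0603fe2c9b6e), over the PROVED chain G11a (`X5/TwoAdicTargetsEnd.lean`). THEOREMS ONLY.

* **G11b `upperBoundAtTwo_goodOrd_of_katoDivisibilityAtTwoUpTo`** (PROVED over G11a): Greenberg@2
  (`TwoAdicEulerCharRankZero W 0`) + modularity + GZK + `KatoDivisibilityAtTwoUpTo W k f` at level
  `N_E` + a bound `−m ≤ ord₂ ϖ` on the period ratios ⇒ the GoodOrd half of
  `O1.UpperBoundAtTwoOfBigImage W (k + m)` (rank `0`).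
* **G11c `upperBoundAtTwoOfBigImage_of_goodOrd_of_mult`** (bookkeeping): the `GoodOrd ∨ Mult` target
  splits into its two halves (the multiplicative half needs the Tate-curve `2`-adic `L`:
  `KatoDivisibilityAtTwoMultUpTo` + an Euler-characteristic formula at multiplicative `2`, untyped).
* **G11d `bsdp_two_goodOrd_of_kato_slack_le_one`** (PROVED): G11b at `k + m ≤ 1` + the certified lower
  half `MissingLowerBoundAt W 2` + `ShaAnTwoAdicValEven` + Cassels–Tate ⇒ `BSD(E,2)` per pair, via the
  slack-one consumer G9 (`missingPPartAt_two_of_lowerBound_of_slack_one`, `X5/TwoAdicTargetsB.lean`).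
* **G11e `padicValRat_varpi_eq_zero_of_unit`** (bookkeeping): a period-unit statement
  `Ω(W) = u · Ω⁺_f`, `|u|₂ = 1` forces `ord₂ ϖ = 0` for every period ratio, i.e. `m = 0`; hence
  **G11b′ `upperBoundAtTwo_goodOrd_of_kato_of_periodUnit`** and **G11d′
  `bsdp_two_goodOrd_of_kato_le_one_of_periodUnit`** (slack `k` alone). The period-unit input
  (A-PER2 of the PLAN = the `p = 2` companion of the Literature facts
  `realPeriodRat_eq_unit_mul_plusPeriod*`: Greenberg–Vatsal 2000 Rem. 3.4 at `2`, from `2 ∤ c₀` —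
  tree facts `abbesUllmo_not_dvd_maninConstant_of_not_dvd_level` (`2 ∤ N`) /
  `cesnavicius_not_two_dvd_maninConstant_of_two_dvd_level` (`2 ∥ N`) — and "every isogeny inside an
  `E[2]`-irreducible class has odd degree") is NOT minted here as a `def`: it is a Literature-side
  theorem-to-be and enters as the explicit per-curve hypothesis `hper`.

NET (PLAN C19/C24/C25b made kernel-shaped): on O1-A-go ∧ r0 (good ordinary `2`, `ρ_{E,2^∞}`
surjective, rank `0`; 434 of the 5 275 r0 residue cells) the END-STATE slack is `n ≤ k` ALONE once
`m = 0` — `δ_alg = 0` is Greenberg 4.1 at `2` IN PRINT. Nothing is booked; `BSD(E,2)` on any residue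
cell still needs the E2 target `KatoDivisibilityAtTwoUpTo W k f` at `k ≤ 1` (NOT in print) and a
certified lower bound (descent engines; `MissingLowerBoundAt W 2`).

References: [GreenbergLNM1716] Thm. 4.1 (p. 102); [Kato2004Asterisque] Thm. 17.4 (p. 273);
[Miller2011LMS] Def. 1.1; [SilvermanAEC2009] Thm. X.4.14; [GreenbergVatsal2000] §3 Rem. 3.4.
-/

set_option autoImplicit false

noncomputable section

open scoped Classical MatrixGroups ModularForm

open CongruenceSubgroup WeierstrassCurve Literature.NumberTheory.EllipticCurves
  Literature.NumberTheory.EllipticCurves.ModularForms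
  Literature.NumberTheory.EllipticCurves.Wuthrich2014
  Literature.NumberTheory.EllipticCurves.Rank1Residual
  Literature.NumberTheory.EllipticCurves.Rank1Residual.Typed

namespace Summit.BirchSwinnertonDyer.Rank1Residual.X5.O1

variable (W : WeierstrassCurve ℚ) [W.IsElliptic] [W.IsGloballyMinimal]

/-! ## G11b–d — the END-STATE consumers on O1-A-go ∧ r0 -/

/-- **G11b (END-STATE at `2`, good-ordinary half).** Granted Greenberg@2 (`hEC`, slot `δ = 0`),
modularity (`hmod`), GZK (`hGZK`), the E2 target `KatoDivisibilityAtTwoUpTo W k f` for every newform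
at level `N_E`, and a bound `−m ≤ ord₂ ϖ` on every period ratio of that newform: for `r_an = 0`,
good ordinary `2`, `ρ_{E,2^∞}` surjective, `∃ q, #Ш_an = q ∧ ord₂ #Ш ≤ ord₂ q + (k + m)` — the
`GoodOrd` half of `O1.UpperBoundAtTwoOfBigImage W (k + m)`. Over G11a with Miller's currency
`#Ш_an = t · #E(ℚ)² / ∏ c_ℓ` (`shaAn_eq_of_L_one_div_eq`). [cite: Miller2011LMS, Def. 1.1 and §1]
[cite: GreenbergLNM1716, Thm. 4.1 (p. 102)] -/
theorem upperBoundAtTwo_goodOrd_of_katoDivisibilityAtTwoUpTo (hEC : TwoAdicEulerCharRankZero W 0)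
    (hmod : nonempty_modularParametrizationData)
    (hGZK : rank_eq_analyticRank_of_analyticRank_le_one) (k m : ℕ)
    (hK : ∀ [NeZero (W.conductorNorm ℤ)] (f : CuspForm (Gamma0 (W.conductorNorm ℤ)) 2),
      KatoDivisibilityAtTwoUpTo W k f)
    (hϖ : ∀ [NeZero (W.conductorNorm ℤ)] (f : CuspForm (Gamma0 (W.conductorNorm ℤ)) 2),
      IsNewformOf W f → ∀ ϖ : ℚ, (ϖ : ℝ) * W.realPeriodRat = plusPeriod f →
        -(m : ℤ) ≤ padicValRat 2 ϖ)
    (hr : W.analyticRank = 0) (hgo : GoodOrd W 2) (him : TwoAdicSurjective W) :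
    ∃ q : ℚ, shaAn W = (q : ℂ) ∧ (padicValNat 2 W.shaOrder : ℤ) ≤ padicValRat 2 q + (k + m) := by
  obtain ⟨-, hfin⟩ := hGZK W (by rw [hr]; exact zero_le_one)
  have hord : IsOrdinaryAt W 2 := hgo
  haveI : NeZero (W.conductorNorm ℤ) := ⟨(W.conductorNorm_pos_holds).ne'⟩
  obtain ⟨Dm⟩ := hmod W
  have hf : IsNewformOf W Dm.f := Dm.isNewformOf
  have hL : W.entireLFunction 1 ≠ 0 :=
    (W.analyticRank_eq_zero_iff_holds hf.hasEntireLFunction).mp hr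
  obtain ⟨ϖ, -, hϖeq, -⟩ := Dm.exists_rat_mul_realPeriodRat_eq_plusPeriod
  obtain ⟨κ, hκ, γ, hγ, hγ'⟩ := exists_isCyclotomic_isTopGenerator_isCyclotomicVariable_holds 2
  obtain ⟨D⟩ := W.nonempty_selmerDualData_holds κ γ hγ
  obtain ⟨hX, n, g, hnk, hg, hι⟩ := hK Dm.f κ γ hκ hγ hγ' hord hf him D
  obtain ⟨t, ht, hle, -⟩ := chainUpperAtTwo_of_divisibilityUpTo W hEC hord hL hfin hκ hγ hγ' hf D
    ϖ hϖeq n ⟨hX, g, hg, hι⟩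
  have hmϖ := hϖ Dm.f hf ϖ hϖeq
  -- Miller's currency: `#Ш_an = t · #E(ℚ)² / ∏ c_ℓ`
  obtain ⟨-, hE, -, hshaAn⟩ := shaAn_eq_of_L_one_div_eq hGZK W hL ht
  haveI := hE
  have hΩ : (W.realPeriodRat : ℂ) ≠ 0 := by exact_mod_cast W.realPeriodRat_pos_holds.ne'
  have ht0 : t ≠ 0 := by
    rintro rfl
    apply hL
    rw [Rat.cast_zero, div_eq_zero_iff] at ht
    exact ht.resolve_right hΩ
  have hcard : (Nat.card W.toAffine.Point : ℚ) ≠ 0 := by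
    exact_mod_cast (Nat.card_pos (α := W.toAffine.Point)).ne'
  have htam : (W.tamagawaProduct : ℚ) ≠ 0 := by
    exact_mod_cast (W.tamagawaProduct_pos_holds : 0 < W.tamagawaProduct).ne'
  have hcardT : (Nat.card W.toAffine.Point : ℚ) = (W.torsionOrder : ℚ) := by
    exact_mod_cast (W.torsionOrder_eq_natCard_of_finite).symm
  refine ⟨t * (Nat.card W.toAffine.Point : ℚ) ^ 2 / (W.tamagawaProduct : ℚ), hshaAn, ?_⟩
  rw [padicValRat.div (mul_ne_zero ht0 (pow_ne_zero 2 hcard)) htam,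
    padicValRat.mul ht0 (pow_ne_zero 2 hcard), padicValRat.pow, hcardT]
  simp only [padicValRat.of_nat, Nat.cast_ofNat]
  have hnk' : (n : ℤ) ≤ k := by exact_mod_cast hnk
  linarith

omit [W.IsElliptic] in
/-- **G11c (bookkeeping) — `UpperBoundAtTwoOfBigImage W δ` from its two halves.** The
multiplicative half (`Mult W 2`: Tate-curve `2`-adic `L`, `KatoDivisibilityAtTwoMultUpTo` + an
Euler-characteristic formula at multiplicative `2`, neither consumer typed yet) enters as the
hypothesis `hmult`; this records that the `GoodOrd ∨ Mult` disjunction of the typed target splits.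
[cite: Miller2011LMS, Def. 1.1] -/
theorem upperBoundAtTwoOfBigImage_of_goodOrd_of_mult (δ : ℕ)
    (hgo : ¬ W.HasCM → W.analyticRank = 0 → GoodOrd W 2 → TwoAdicSurjective W →
      ∃ q : ℚ, shaAn W = (q : ℂ) ∧ (padicValNat 2 W.shaOrder : ℤ) ≤ padicValRat 2 q + δ)
    (hmult : ¬ W.HasCM → W.analyticRank = 0 → Mult W 2 → TwoAdicSurjective W →
      ∃ q : ℚ, shaAn W = (q : ℂ) ∧ (padicValNat 2 W.shaOrder : ℤ) ≤ padicValRat 2 q + δ) :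
    UpperBoundAtTwoOfBigImage W δ := by
  intro hcm hr hred him
  rcases hred with hred | hred
  · exact hgo hcm hr hred him
  · exact hmult hcm hr hred him

/-- **G11d (per-pair closure shape) — `BSD(E,2)` at total slack `≤ 1` on O1-A-go ∧ r0.** From G11b
at `k + m ≤ 1`, the certified lower half `MissingLowerBoundAt W 2`, evenness of `ord₂ #Ш_an`
(`ShaAnTwoAdicValEven`, from a rank-`0` certificate) and Cassels–Tate, via the slack-one consumer G9
(`missingPPartAt_two_of_lowerBound_of_slack_one`). [cite: Miller2011LMS, Def. 1.1]
[cite: SilvermanAEC2009, Thm. X.4.14 (Cassels–Tate ⇒ #Ш square)] -/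
theorem bsdp_two_goodOrd_of_kato_slack_le_one (hCT : exists_casselsTate_pairing (K := ℚ))
    (hEC : TwoAdicEulerCharRankZero W 0) (hmod : nonempty_modularParametrizationData)
    (hGZK : rank_eq_analyticRank_of_analyticRank_le_one) (k m : ℕ) (hkm : k + m ≤ 1)
    (hK : ∀ [NeZero (W.conductorNorm ℤ)] (f : CuspForm (Gamma0 (W.conductorNorm ℤ)) 2),
      KatoDivisibilityAtTwoUpTo W k f)
    (hϖ : ∀ [NeZero (W.conductorNorm ℤ)] (f : CuspForm (Gamma0 (W.conductorNorm ℤ)) 2),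
      IsNewformOf W f → ∀ ϖ : ℚ, (ϖ : ℝ) * W.realPeriodRat = plusPeriod f →
        -(m : ℤ) ≤ padicValRat 2 ϖ)
    (hcm : ¬ W.HasCM) (hr : W.analyticRank = 0) (hgo : GoodOrd W 2) (him : TwoAdicSurjective W)
    (heven : ShaAnTwoAdicValEven W) (hlow : MissingLowerBoundAt W 2) : BSDp W 2 := by
  haveI : Finite W.sha := (hGZK W (by rw [hr]; exact zero_le_one)).2
  obtain ⟨q, hq, hup⟩ :=
    upperBoundAtTwo_goodOrd_of_katoDivisibilityAtTwoUpTo W hEC hmod hGZK k m hK hϖ hr hgo him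
  have hev : Even (padicValRat 2 q) := by
    obtain ⟨q', hq', -, hev'⟩ := heven (by rw [hr]; exact zero_le_one) hcm
    have hqq : q' = q := by exact_mod_cast hq'.symm.trans hq
    subst hqq
    exact hev'
  refine bsdp_of_missingPPartAt W 2 hGZK (by rw [hr]; exact zero_le_one)
    (missingPPartAt_two_of_lowerBound_of_slack_one W hCT hlow ⟨q, hq, hev, ?_⟩)
  have hkm' : (k : ℤ) + (m : ℤ) ≤ 1 := by exact_mod_cast hkm
  linarith

/-! ## G11e — the period-unit input at `2` discharges `hϖ` at `m = 0` -/

omit [W.IsElliptic] [W.IsGloballyMinimal] in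
/-- **G11e (bookkeeping): a period-unit statement at `2` discharges `hϖ` at `m = 0`** — if
`Ω(W) = u · Ω⁺_f` with `|u|₂ = 1` then every `ϖ` with `ϖ · Ω(W) = Ω⁺_f` has `ord₂ ϖ = 0`. (A-PER2 =
the `p = 2` companion of the Literature facts `realPeriodRat_eq_unit_mul_plusPeriod*`: Greenberg–Vatsal
2000 Rem. 3.4 at `2` from `2 ∤ c₀` — Abbes–Ullmo 1996 Thm. A for `2 ∤ N`, Česnavičius 2018 Thm. 1.2 for
`2 ∥ N` — and "every isogeny in an `E[2]`-irreducible class has odd degree"; a Literature-side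
theorem-to-be, taken below as the explicit per-curve hypothesis `hper`, NOT minted as a `def`.)
[cite: GreenbergVatsal2000, §3 Rem. 3.4 (shape at p = 2)] -/
theorem padicValRat_varpi_eq_zero_of_unit {N : ℕ} [NeZero N] {f : CuspForm (Gamma0 N) 2}
    (hf : IsNewformOf W f) {u : ℚ} (hu : ‖(u : ℚ_[2])‖ = 1)
    (hΩ : W.realPeriodRat = u * plusPeriod f) {ϖ : ℚ}
    (hϖ : (ϖ : ℝ) * W.realPeriodRat = plusPeriod f) : padicValRat 2 ϖ = 0 := by
  have hper : 0 < plusPeriod f := IsNewform0.plusPeriod_pos_holds hf.1 hf.coeffField_eq_bot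
  have hprod : ((ϖ * u : ℚ) : ℝ) = 1 := by
    have h1 : ((ϖ : ℝ) * u) * plusPeriod f = 1 * plusPeriod f := by
      rw [one_mul, mul_assoc, ← hΩ, hϖ]
    have h2 := mul_right_cancel₀ hper.ne' h1
    push_cast
    exact h2
  have hprodQ : ϖ * u = 1 := by exact_mod_cast hprod
  have hu0 : u ≠ 0 := by
    rintro rfl
    simp at hprodQ
  have hϖ0 : ϖ ≠ 0 := by
    rintro rfl
    simp at hprodQ
  have huval : padicValRat 2 u = 0 := by
    have huQ0 : (u : ℚ_[2]) ≠ 0 := by exact_mod_cast hu0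
    have h := Padic.norm_eq_zpow_neg_valuation huQ0
    rw [hu, Padic.valuation_ratCast] at h
    have h' : ((2 : ℕ) : ℝ) ^ (-padicValRat 2 u) = 1 := h.symm
    have h2 : (-padicValRat 2 u) = 0 :=
      (zpow_eq_one_iff_right₀ (by norm_num) (by norm_num)).mp h'
    linarith
  have hsum : padicValRat 2 ϖ + padicValRat 2 u = 0 := by
    rw [← padicValRat.mul hϖ0 hu0, hprodQ, padicValRat.one]
  linarith

/-- **G11b′ — the END-STATE at `m = 0` under the period-unit hypothesis.** With `hper` (A-PER2 for
this curve: `Ω(W) = u · Ω⁺_f`, `|u|₂ = 1`, for the newform at level `N_E`) the slack of G11b is `k`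
alone: `ord₂ #Ш ≤ ord₂ #Ш_an + k` on a rank-`0`, good-ordinary-`2`, `2`-adically surjective curve,
granted Greenberg@2 and `KatoDivisibilityAtTwoUpTo W k f`. [cite: Miller2011LMS, Def. 1.1]
[cite: GreenbergVatsal2000, §3 Rem. 3.4 (shape at p = 2)] -/
theorem upperBoundAtTwo_goodOrd_of_kato_of_periodUnit (hEC : TwoAdicEulerCharRankZero W 0)
    (hmod : nonempty_modularParametrizationData)
    (hGZK : rank_eq_analyticRank_of_analyticRank_le_one) (k : ℕ)
    (hK : ∀ [NeZero (W.conductorNorm ℤ)] (f : CuspForm (Gamma0 (W.conductorNorm ℤ)) 2),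
      KatoDivisibilityAtTwoUpTo W k f)
    (hper : ∀ [NeZero (W.conductorNorm ℤ)] (f : CuspForm (Gamma0 (W.conductorNorm ℤ)) 2),
      IsNewformOf W f → ∃ u : ℚ, ‖(u : ℚ_[2])‖ = 1 ∧ W.realPeriodRat = u * plusPeriod f)
    (hr : W.analyticRank = 0) (hgo : GoodOrd W 2) (him : TwoAdicSurjective W) :
    ∃ q : ℚ, shaAn W = (q : ℂ) ∧ (padicValNat 2 W.shaOrder : ℤ) ≤ padicValRat 2 q + k := by
  have h := upperBoundAtTwo_goodOrd_of_katoDivisibilityAtTwoUpTo W hEC hmod hGZK k 0 hK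
    (fun f hf ϖ hϖ => by
      obtain ⟨u, hu, hΩ⟩ := hper f hf
      rw [padicValRat_varpi_eq_zero_of_unit W hf hu hΩ hϖ]
      simp) hr hgo him
  simpa using h

/-- **G11d′ — `BSD(E,2)` per pair at `k ≤ 1` on O1-A-go ∧ r0 under the period-unit hypothesis.**
G11d with `m = 0` supplied by `hper` (A-PER2 for this curve). [cite: Miller2011LMS, Def. 1.1]
[cite: SilvermanAEC2009, Thm. X.4.14] -/
theorem bsdp_two_goodOrd_of_kato_le_one_of_periodUnit (hCT : exists_casselsTate_pairing (K := ℚ))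
    (hEC : TwoAdicEulerCharRankZero W 0) (hmod : nonempty_modularParametrizationData)
    (hGZK : rank_eq_analyticRank_of_analyticRank_le_one) (k : ℕ) (hk : k ≤ 1)
    (hK : ∀ [NeZero (W.conductorNorm ℤ)] (f : CuspForm (Gamma0 (W.conductorNorm ℤ)) 2),
      KatoDivisibilityAtTwoUpTo W k f)
    (hper : ∀ [NeZero (W.conductorNorm ℤ)] (f : CuspForm (Gamma0 (W.conductorNorm ℤ)) 2),
      IsNewformOf W f → ∃ u : ℚ, ‖(u : ℚ_[2])‖ = 1 ∧ W.realPeriodRat = u * plusPeriod f)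
    (hcm : ¬ W.HasCM) (hr : W.analyticRank = 0) (hgo : GoodOrd W 2) (him : TwoAdicSurjective W)
    (heven : ShaAnTwoAdicValEven W) (hlow : MissingLowerBoundAt W 2) : BSDp W 2 :=
  bsdp_two_goodOrd_of_kato_slack_le_one W hCT hEC hmod hGZK k 0 (by simpa using hk) hK
    (fun f hf ϖ hϖ => by
      obtain ⟨u, hu, hΩ⟩ := hper f hf
      rw [padicValRat_varpi_eq_zero_of_unit W hf hu hΩ hϖ]
      simp) hcm hr hgo him heven hlow

end Summit.BirchSwinnertonDyer.Rank1Residual.X5.O1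

end
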